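import Literature.Computability.AlgebraicComplexity.ArithCircuitCodeBounds
import Literature.Computability.Complexity.RandomizedModularZeroTest
import HarnessLib

/-!
# Good primes of controlled bit-length for a nonzero integer polynomial

A nonzero integer `N` with `|N| ≤ 2^T` has at most `T` prime divisors, while there are at least
`2^K/(2K) - 2` primes below `2^K` (Chebyshev); hence for every threshold `M` there is a prime
`M < p < 2^K` not dividing `N` as soon as `2^K/(2K) - 2 > M + 1 + T`, and the explicit bit-length
`K = 2·log₂(M + T + 3) + 6` always suffices (`exists_prime_btwn_not_dvd`,
`exists_prime_btwn_not_dvd_explicit`).  Applied to one nonzero coefficient of a nonzero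
`D ∈ ℤ[x_σ]` of weight `wt(D) ≤ 2^T` this gives a prime `p` of bit-length `O(T + log M)`, above any
prescribed threshold `M`, with `D mod p ≠ 0` (`MvPolynomial.exists_prime_map_zmod_ne_zero`; ONE prime
for a finite family `D_i`, `Σ T_i` in place of `T`: `MvPolynomial.exists_prime_forall_map_zmod_ne_zero`,
`exists_prime_btwn_forall_not_dvd`); for the
polynomial computed by an integer circuit with constants `≤ A` the weight bound
`wt ≤ A^(2^(e+s))` (`ArithCircuit.weight_eval_le_of_constLe`, Bürgisser 2000 TCS Lemma 2.4) makes
`T = (log₂ A + 1)·2^(e+s)`, so the bit-length of `p` is linear in the number `e + s` of wires and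
gates (`ArithCircuit.exists_prime_map_eval_zmod_ne_zero`).

This is the deterministic «good prime by counting» step of reduction-mod-`p` arguments
(Arora–Barak 2009 §7.2.3 fingerprinting; Bürgisser 2000 TCS §4; used in the tree's route of
record to `BIJL2018_thm6`, cell val-lit memo `MEMO-p1g6-BIJL18-thm6-route.md`, whose consumer
`complexity_perPoly_zmod_le_of_thm24` asks exactly for `map (Int.castRingHom (ZMod p)) D ≠ 0` and
`deg D < p`).  Theorems only; no new definitions, no named facts.  Honest framing: elementary
counting; nothing here bears on `VP ≠ VNP`, which is NOT proved.
-/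

namespace Literature.Computability.AlgebraicComplexity

open Finset

/-! ### Counting: a prime in `(M, 2^K)` avoiding the divisors of `N` -/

section Counting

/-- **A prime between `M` and `2^K` not dividing `N`.**  If `N ≠ 0`, `N ≤ 2^T` and
`2^K/(2K) - 2 > M + 1 + T` (`K ≥ 2`), some prime `p` with `M < p < 2^K` does not divide `N`:
of the `≥ 2^K/(2K) - 2` primes below `2^K` at most `M + 1` are `≤ M` and at most `T` divide `N`.
[cite: HardyWright2008, Thm. 414 and §22.10] -/
theorem exists_prime_btwn_not_dvd {N T M K : ℕ} (hN : N ≠ 0) (hNT : N ≤ 2 ^ T) (hK : 2 ≤ K)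
    (hroom : ((M : ℝ) + 1 + T) < (2 : ℝ) ^ K / (2 * K) - 2) :
    ∃ p : ℕ, p.Prime ∧ M < p ∧ p < 2 ^ K ∧ ¬ p ∣ N := by
  classical
  set P : Finset ℕ := (2 ^ K).primesBelow with hP
  -- the two kinds of bad primes
  set B₁ : Finset ℕ := P.filter fun p => p ≤ M with hB₁
  set B₂ : Finset ℕ := P.filter fun p => p ∣ N with hB₂
  have hB₁card : B₁.card ≤ M + 1 := by
    have hsub : B₁ ⊆ range (M + 1) := by
      intro p hp
      rw [hB₁, mem_filter] at hp
      exact mem_range.2 (Nat.lt_succ_of_le hp.2)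
    simpa using card_le_card hsub
  have hB₂card : B₂.card ≤ T := by
    have hsub : B₂ ⊆ N.primeFactors := by
      intro p hp
      rw [hB₂, mem_filter, hP, Nat.mem_primesBelow] at hp
      exact Nat.mem_primeFactors.2 ⟨hp.1.2, hp.2, hN⟩
    exact (card_le_card hsub).trans
      (Literature.Computability.Complexity.ModularZeroTest.card_primeFactors_le_of_le_two_pow hN hNT)
  -- many primes below `2^K`
  have hPcard : M + 1 + T < P.card := by
    have h := Literature.Computability.Complexity.ModularZeroTest.card_primesBelow_two_pow_ge hK
    have h' : ((M : ℝ) + 1 + T) < (P.card : ℝ) := lt_of_lt_of_le hroom h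
    exact_mod_cast h'
  -- hence some prime below `2^K` is in neither bad set
  by_contra hcon
  push Not at hcon
  have hcover : P ⊆ B₁ ∪ B₂ := by
    intro p hp
    have hp' := hp
    rw [hP, Nat.mem_primesBelow] at hp'
    rw [mem_union, hB₁, hB₂, mem_filter, mem_filter]
    by_cases hpM : p ≤ M
    · exact Or.inl ⟨hp, hpM⟩
    · exact Or.inr ⟨hp, by
        by_contra hnd
        exact hnd (hcon p hp'.2 (lt_of_not_ge hpM) hp'.1) ⟩
  have := (card_le_card hcover).trans (card_union_le _ _)
  omega

/-- The explicit bit-length `K = 2·log₂(M + T + 3) + 6` leaves room: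
`2·K·(M + T + 4) ≤ 2^K`. [folklore] -/
private theorem two_mul_goodPrimeBits_mul_le (M T : ℕ) :
    2 * (2 * Nat.log 2 (M + T + 3) + 6) * (M + T + 4) ≤ 2 ^ (2 * Nat.log 2 (M + T + 3) + 6) := by
  set S := M + T + 3 with hS
  set L := Nat.log 2 S + 1 with hL
  have hSL : S < 2 ^ L := Nat.lt_pow_succ_log_self one_lt_two S
  have hK : 2 * Nat.log 2 (M + T + 3) + 6 = 2 * L + 4 := by rw [hL]; ring
  rw [hK]
  have hL2 : L + 2 ≤ 4 * 2 ^ L := by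
    have := Nat.lt_two_pow_self (n := L)
    omega
  have h1 : 2 * (2 * L + 4) ≤ 16 * 2 ^ L := by omega
  have h2 : M + T + 4 ≤ 2 ^ L := by omega
  calc 2 * (2 * L + 4) * (M + T + 4) ≤ 16 * 2 ^ L * 2 ^ L := Nat.mul_le_mul h1 h2
    _ = 2 ^ (2 * L + 4) := by
      rw [show 2 * L + 4 = 4 + L + L by ring, pow_add, pow_add]; ring

/-- **Explicit bit-length.**  If `N ≠ 0` and `N ≤ 2^T`, then for every `M` there is a prime
`M < p < 2^K` not dividing `N`, where `K = 2·log₂(M + T + 3) + 6` — i.e. `p` has `O(T + log M)`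
bits. [cite: HardyWright2008, Thm. 414 and §22.10] -/
theorem exists_prime_btwn_not_dvd_explicit {N T : ℕ} (hN : N ≠ 0) (hNT : N ≤ 2 ^ T) (M : ℕ) :
    ∃ p : ℕ, p.Prime ∧ M < p ∧ p < 2 ^ (2 * Nat.log 2 (M + T + 3) + 6) ∧ ¬ p ∣ N := by
  set K := 2 * Nat.log 2 (M + T + 3) + 6 with hKdef
  have hK2 : 2 ≤ K := by omega
  refine exists_prime_btwn_not_dvd hN hNT hK2 ?_
  have hnat : 2 * K * (M + T + 4) ≤ 2 ^ K := two_mul_goodPrimeBits_mul_le M T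
  have hK0 : (0 : ℝ) < 2 * K := by positivity
  have hreal : (2 : ℝ) * K * ((M : ℝ) + T + 4) ≤ (2 : ℝ) ^ K := by exact_mod_cast hnat
  have hdiv : ((M : ℝ) + T + 4) ≤ (2 : ℝ) ^ K / (2 * K) := by
    rw [le_div_iff₀ hK0]
    linarith
  linarith

/-- **One prime for a finite family.**  If `N i ≠ 0` and `N i ≤ 2^(T i)` for `i ∈ s`, then for
every `M` there is a prime `M < p < 2^K`, `K = 2·log₂(M + Σ_{i ∈ s} T i + 3) + 6`, dividing NO
`N i` (apply the single version to `∏ N i ≤ 2^(Σ T i)`). [cite: HardyWright2008, Thm. 414 and §22.10] -/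
theorem exists_prime_btwn_forall_not_dvd {ι : Type*} (s : Finset ι) {N T : ι → ℕ}
    (hN : ∀ i ∈ s, N i ≠ 0) (hNT : ∀ i ∈ s, N i ≤ 2 ^ T i) (M : ℕ) :
    ∃ p : ℕ, p.Prime ∧ M < p ∧ p < 2 ^ (2 * Nat.log 2 (M + (∑ i ∈ s, T i) + 3) + 6) ∧
      ∀ i ∈ s, ¬ p ∣ N i := by
  have hprod : (∏ i ∈ s, N i) ≠ 0 := Finset.prod_ne_zero_iff.2 hN
  have hle : (∏ i ∈ s, N i) ≤ 2 ^ (∑ i ∈ s, T i) := by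
    rw [← Finset.prod_pow_eq_pow_sum]
    exact Finset.prod_le_prod' hNT
  obtain ⟨p, hp, hMp, hpK, hnd⟩ := exists_prime_btwn_not_dvd_explicit hprod hle M
  exact ⟨p, hp, hMp, hpK, fun i hi hdvd => hnd (hdvd.trans (Finset.dvd_prod_of_mem N hi))⟩

end Counting

/-! ### Integer polynomials: a good prime for the reduction mod `p` -/

section Polynomial

open MvPolynomial

variable {σ : Type*}

/-- One coefficient is bounded by the weight: `|coeff m f| ≤ wt(f)` (a Summits-side twin of the same
name exists in `Theorems/GaugeDescentDescentGlueTransfer.lean`, which Literature cannot import). [cite: Burgisser2000TCS, p. 76] -/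
theorem natAbs_coeff_le_weight (f : MvPolynomial σ ℤ) (m : σ →₀ ℕ) :
    (f.coeff m).natAbs ≤ weight f := by
  classical
  by_cases hm : m ∈ f.support
  · exact Finset.single_le_sum (f := fun m => (f.coeff m).natAbs) (fun _ _ => Nat.zero_le _) hm
  · rw [MvPolynomial.notMem_support_iff.1 hm]
    simp

/-- The reduction of an integer polynomial modulo `p` is nonzero as soon as `p` misses ONE of
its nonzero coefficients. [cite: Burgisser2000TCS, §4 p. 79 (reduction modulo primes)] -/
theorem map_intCast_zmod_ne_zero_of_not_dvd {p : ℕ} (f : MvPolynomial σ ℤ)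
    (m : σ →₀ ℕ) (hm : ¬ p ∣ (f.coeff m).natAbs) :
    MvPolynomial.map (Int.castRingHom (ZMod p)) f ≠ 0 := by
  intro h
  have hc : MvPolynomial.coeff m (MvPolynomial.map (Int.castRingHom (ZMod p)) f) = 0 := by
    rw [h, MvPolynomial.coeff_zero]
  rw [MvPolynomial.coeff_map, eq_intCast, ZMod.intCast_zmod_eq_zero_iff_dvd] at hc
  exact hm (Int.natCast_dvd.1 hc)

/-- **A good prime for a nonzero integer polynomial, with controlled bit-length.**  If `D ≠ 0`
and `wt(D) ≤ 2^T`, then for every threshold `M` there is a prime `p` with `M < p`,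
`p < 2^(2·log₂(M + T + 3) + 6)` and `D mod p ≠ 0` (as a polynomial over `𝔽_p = ZMod p`).  Taking
`M ≥ deg D` (and `≥` any further thresholds) supplies the hypotheses `map … D ≠ 0`, `deg D < p`
of reduction-mod-`p` statements such as `complexity_perPoly_zmod_le_of_thm24`.
[cite: Burgisser2000TCS, §4 p. 79 (reduction modulo primes)] [cite: HardyWright2008, Thm. 414 and §22.10] -/
theorem _root_.MvPolynomial.exists_prime_map_zmod_ne_zero (D : MvPolynomial σ ℤ) (hD : D ≠ 0)
    {T : ℕ} (hwt : weight D ≤ 2 ^ T) (M : ℕ) :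
    ∃ p : ℕ, p.Prime ∧ M < p ∧ p < 2 ^ (2 * Nat.log 2 (M + T + 3) + 6) ∧
      MvPolynomial.map (Int.castRingHom (ZMod p)) D ≠ 0 := by
  obtain ⟨m, hm⟩ := MvPolynomial.ne_zero_iff.1 hD
  have hN : (D.coeff m).natAbs ≠ 0 := Int.natAbs_ne_zero.2 hm
  have hNT : (D.coeff m).natAbs ≤ 2 ^ T := (natAbs_coeff_le_weight D m).trans hwt
  obtain ⟨p, hp, hMp, hpK, hnd⟩ := exists_prime_btwn_not_dvd_explicit hN hNT M
  exact ⟨p, hp, hMp, hpK, map_intCast_zmod_ne_zero_of_not_dvd D m hnd⟩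

/-- Threshold form: the same prime exceeds the total degree and any extra bound `B` when
`M := max (D.totalDegree) B`. [cite: Burgisser2000TCS, §4 p. 79] -/
theorem _root_.MvPolynomial.exists_prime_map_zmod_ne_zero_gt (D : MvPolynomial σ ℤ) (hD : D ≠ 0)
    {T : ℕ} (hwt : weight D ≤ 2 ^ T) (B : ℕ) :
    ∃ p : ℕ, p.Prime ∧ D.totalDegree < p ∧ B < p ∧
      p < 2 ^ (2 * Nat.log 2 (max D.totalDegree B + T + 3) + 6) ∧
      MvPolynomial.map (Int.castRingHom (ZMod p)) D ≠ 0 := by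
  obtain ⟨p, hp, hMp, hpK, hne⟩ := D.exists_prime_map_zmod_ne_zero hD hwt (max D.totalDegree B)
  exact ⟨p, hp, lt_of_le_of_lt (le_max_left _ _) hMp, lt_of_le_of_lt (le_max_right _ _) hMp, hpK, hne⟩

/-- **One good prime for a finite family of nonzero integer polynomials** (possibly in different
variable sets): if `D i ≠ 0` and `wt(D i) ≤ 2^(T i)` for `i ∈ s`, then for every `M` there is a
prime `M < p < 2^(2·log₂(M + Σ_{i ∈ s} T i + 3) + 6)` with `D i mod p ≠ 0` for EVERY `i ∈ s` — the
shape needed when one modulus serves a whole sequence `D_1, …, D_n` (as in the verifier of the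
route to BIJL18 Thm. 6, which guesses ONE prime).
[cite: Burgisser2000TCS, §4 p. 79 (reduction modulo primes)] [cite: HardyWright2008, Thm. 414 and §22.10] -/
theorem _root_.MvPolynomial.exists_prime_forall_map_zmod_ne_zero {ι : Type*} {τ : ι → Type*}
    (s : Finset ι) (D : ∀ i, MvPolynomial (τ i) ℤ) {T : ι → ℕ} (hD : ∀ i ∈ s, D i ≠ 0)
    (hwt : ∀ i ∈ s, weight (D i) ≤ 2 ^ T i) (M : ℕ) :
    ∃ p : ℕ, p.Prime ∧ M < p ∧ p < 2 ^ (2 * Nat.log 2 (M + (∑ i ∈ s, T i) + 3) + 6) ∧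
      ∀ i ∈ s, MvPolynomial.map (Int.castRingHom (ZMod p)) (D i) ≠ 0 := by
  classical
  -- a nonzero coefficient of each `D i`, `i ∈ s` (junk index outside `s`)
  have hm : ∀ i, ∃ m : τ i →₀ ℕ, i ∈ s → (D i).coeff m ≠ 0 := by
    intro i
    by_cases hi : i ∈ s
    · obtain ⟨m, hm⟩ := MvPolynomial.ne_zero_iff.1 (hD i hi)
      exact ⟨m, fun _ => hm⟩
    · exact ⟨0, fun h => absurd h hi⟩
  choose m hm using hm
  have hN : ∀ i ∈ s, ((D i).coeff (m i)).natAbs ≠ 0 := fun i hi => Int.natAbs_ne_zero.2 (hm i hi)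
  have hNT : ∀ i ∈ s, ((D i).coeff (m i)).natAbs ≤ 2 ^ T i :=
    fun i hi => (natAbs_coeff_le_weight (D i) (m i)).trans (hwt i hi)
  obtain ⟨p, hp, hMp, hpK, hnd⟩ := exists_prime_btwn_forall_not_dvd s hN hNT M
  exact ⟨p, hp, hMp, hpK, fun i hi => map_intCast_zmod_ne_zero_of_not_dvd (D i) (m i) (hnd i hi)⟩

end Polynomial

/-! ### Circuits: the weight bound makes the bit-length linear in wires + gates -/

section Circuit

open MvPolynomial

variable {σ : Type*}

/-- `A^(2^E) ≤ 2^((log₂ A + 1) · 2^E)`. [folklore] -/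
private theorem pow_two_pow_le_two_pow (A E : ℕ) :
    A ^ 2 ^ E ≤ 2 ^ ((Nat.log 2 A + 1) * 2 ^ E) := by
  rw [pow_mul]
  exact Nat.pow_le_pow_left (Nat.lt_pow_succ_log_self one_lt_two A).le _

/-- **A good prime for the polynomial of an integer circuit.**  If `C` has constants and
coefficients of absolute value `≤ A` (`2 ≤ A`), `e` wires and `s` gates, and computes a nonzero
polynomial, then for every threshold `M` there is a prime `p > M` of bit-length at most
`2·log₂(M + (log₂ A + 1)·2^(e+s) + 3) + 6` — linear in `e + s` — with `C.eval mod p ≠ 0`; the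
weight bound `wt(C.eval) ≤ A^(2^(e+s))` is Bürgisser's Lemma 2.4.
[cite: Burgisser2000TCS, Lemma 2.4 p. 77 and §4 p. 79] [cite: HardyWright2008, Thm. 414 and §22.10] -/
theorem ArithCircuit.exists_prime_map_eval_zmod_ne_zero (C : ArithCircuit ℤ σ) {A : ℕ} (hA : 2 ≤ A)
    (hC : C.ConstLe A) (h0 : C.eval ≠ 0) (M : ℕ) :
    ∃ p : ℕ, p.Prime ∧ M < p ∧
      p < 2 ^ (2 * Nat.log 2 (M + (Nat.log 2 A + 1) * 2 ^ (C.edgeSize + C.size) + 3) + 6) ∧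
      MvPolynomial.map (Int.castRingHom (ZMod p)) C.eval ≠ 0 := by
  have hwt : weight C.eval ≤ 2 ^ ((Nat.log 2 A + 1) * 2 ^ (C.edgeSize + C.size)) :=
    (ArithCircuit.weight_eval_le_of_constLe C hA hC).trans (pow_two_pow_le_two_pow A _)
  exact C.eval.exists_prime_map_zmod_ne_zero h0 hwt M

/-- Sign-constant operands have constants of absolute value `≤ 1` (tree:
`natAbs_le_one_of_isSignConstant`). [cite: Burgisser2000, §1.4] -/
theorem ArithCircuit.Operand.HasSignConstants.constLe_one {u : ArithCircuit.Operand ℤ σ}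
    (h : u.HasSignConstants) : u.ConstLe 1 := by
  cases u with
  | var _ => trivial
  | const c => exact natAbs_le_one_of_isSignConstant h
  | gate _ => trivial

/-- Sign-constant gates have constants and coefficients of absolute value `≤ 1`. [cite: Burgisser2000, §1.4] -/
theorem ArithCircuit.Gate.HasSignConstants.constLe_one {g : ArithCircuit.Gate ℤ σ}
    (h : g.HasSignConstants) : g.ConstLe 1 := by
  cases g with
  | sum args => exact fun a ha => ⟨natAbs_le_one_of_isSignConstant (h a ha).1, (h a ha).2.constLe_one⟩
  | prod args => exact fun u hu => (h u hu).constLe_one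

/-- **Sign-constant circuits have `ConstLe 1`** (constants and coefficients in `{0, ±1}`).
[cite: Burgisser2000, §1.4] -/
theorem ArithCircuit.HasSignConstants.constLe_one {C : ArithCircuit ℤ σ} (h : C.HasSignConstants) :
    C.ConstLe 1 :=
  ⟨fun g hg => (h.1 g hg).constLe_one, h.2.constLe_one⟩

/-- Sign-constant circuits (`HasSignConstants`: constants and coefficients in `{0, ±1}`, the
model of `VP⁰`): the bit-length above reads `2·log₂(M + 2·2^(e+s) + 3) + 6`.
[cite: Burgisser2000TCS, Lemma 2.4 p. 77 and §4 p. 79] -/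
theorem ArithCircuit.exists_prime_map_eval_zmod_ne_zero_of_hasSignConstants (C : ArithCircuit ℤ σ)
    (hC : C.HasSignConstants) (h0 : C.eval ≠ 0) (M : ℕ) :
    ∃ p : ℕ, p.Prime ∧ M < p ∧
      p < 2 ^ (2 * Nat.log 2 (M + 2 * 2 ^ (C.edgeSize + C.size) + 3) + 6) ∧
      MvPolynomial.map (Int.castRingHom (ZMod p)) C.eval ≠ 0 := by
  have h := C.exists_prime_map_eval_zmod_ne_zero (le_refl 2) (hC.constLe_one.mono one_le_two) h0 M
  have hlog : Nat.log 2 2 + 1 = 2 := by decide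
  simpa [hlog] using h

end Circuit

end Literature.Computability.AlgebraicComplexity
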